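import Mathlib
import Literature.Probability.Percolation.HarrisInequality

/-!
# Plackett/Piterbarg drift identity for the noise heat flow, part 1: Gaussian integration by parts
# along one coordinate of an infinite product of standard Gaussians

Helper file for crux item `DriftBound` (stmt-CriticalPhenomena-4596) of route `CardyWhiteToColoured`
(`CardyFormulaZ2`), line `registered` (`Cruxes/DriftBound/Lines/birth.lean`, skeleton v3.2, lead c3),
towards the open stub `stub_window` (uniform Cauchy window of the flow `s ↦ P^latt_{s,δ}(R)`).

The intended proof of `stub_window` differentiates the crossing probability of the (regularised,
normalised) smoothed-noise model in the smoothing width `σ`; the exact derivative is the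
Plackett/Piterbarg interpolation identity (Beliaev–Muirhead–Rivera 2020, Lemma 2.22 / Thm 2.14, here
on the lattice: the field is an `ℓ¹`-linear image `X^σ_i = ∑' e, G σ i e ξ_e` of i.i.d. standard
Gaussians `ξ_e`, `e` in a countable index set). This file supplies the one-coordinate Gaussian
calculus on the infinite product `γ∞ = ⨂_e N(0,1)` (Mathlib `Measure.infinitePi`):

* `pl_stein_gaussianReal` — Stein's lemma on `ℝ`: `∫ x g(x) dγ = ∫ g'(x) dγ` for `g ∈ C¹_b`;
* `pl_integral_infinitePi_update` — disintegration of `γ∞` along one coordinate `e`: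
  `∫ F dγ∞ = ∫ (∫ F(update ζ e x) dγ(x)) dγ∞(ζ)` (gluing lemma
  `Literature.Probability.Percolation.infinitePi_prod_map_piecewise` + Fubini);
* `pl_stein_infinitePi` (`pl_stein_infinitePi'`) — **Gaussian integration by parts along coordinate `e` of `γ∞`**:
  `∫ H(ξ) ξ_e dγ∞ = ∫ D(ξ) dγ∞` whenever, for a.e. `ζ`, `t ↦ H(update ζ e t)` has derivative
  `D(update ζ e t)` at every `t`, with `H`, `D` measurable and bounded.

References: D. Beliaev, S. Muirhead, A. Rivera, Ann. Probab. 48 (2020), §2.2 (Piterbarg's formula);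
C. Stein, Proc. Sixth Berkeley Symp. (1972) (Stein's identity).
-/

noncomputable section

namespace Summit.CriticalPhenomena.CardyFormulaZ2.Cruxes.DriftBound.Birth

open MeasureTheory ProbabilityTheory Filter Topology Set
open scoped ENNReal NNReal

/-! ### Stein's lemma on `ℝ` -/

/-- `φ'(x) = -x φ(x)` for the standard Gaussian density `φ = gaussianPDFReal 0 1`. -/
theorem pl_hasDerivAt_gaussianPDFReal (x : ℝ) :
    HasDerivAt (gaussianPDFReal 0 1) (-x * gaussianPDFReal 0 1 x) x := by
  have hdef : gaussianPDFReal 0 1 = fun y => (Real.sqrt (2 * Real.pi))⁻¹ * Real.exp (-y ^ 2 / 2) := by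
    funext y; rw [gaussianPDFReal_def]; simp
  rw [hdef]
  have h1 : HasDerivAt (fun y : ℝ => -y ^ 2 / 2) (-x) x := by
    have h := (((hasDerivAt_id' x).fun_mul (hasDerivAt_id' x)).fun_neg).div_const (2 : ℝ)
    have e1 : (fun y : ℝ => -y ^ 2 / 2) = fun y => -(y * y) / 2 := by funext y; ring
    rw [e1]
    refine h.congr_deriv ?_
    ring
  have h2 := (h1.exp).const_mul ((Real.sqrt (2 * Real.pi))⁻¹)
  refine h2.congr_deriv ?_
  ring

/-- The standard Gaussian is Lebesgue measure with density `φ`. -/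
theorem pl_gaussianReal_eq_withDensity :
    gaussianReal 0 1 = volume.withDensity (gaussianPDF 0 1) :=
  gaussianReal_of_var_ne_zero 0 one_ne_zero

/-- Integrability against `N(0,1)` is integrability of `φ • f` against Lebesgue measure. -/
theorem pl_integrable_gaussianReal_iff (f : ℝ → ℝ) :
    Integrable f (gaussianReal 0 1) ↔ Integrable (fun x => gaussianPDFReal 0 1 x * f x) := by
  rw [pl_gaussianReal_eq_withDensity,
    integrable_withDensity_iff_integrable_smul' (measurable_gaussianPDF 0 1)
      (ae_of_all _ fun _ => gaussianPDF_lt_top)]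
  simp only [toReal_gaussianPDF, smul_eq_mul]

/-- `x ↦ x` is integrable against `N(0,1)`. -/
theorem pl_integrable_id_gaussianReal : Integrable (fun x : ℝ => x) (gaussianReal 0 1) :=
  (memLp_id_gaussianReal (μ := 0) (v := 1) 1).integrable le_rfl

/-- A measurable function bounded in absolute value is integrable against `N(0,1)`. -/
theorem pl_integrable_of_bounded_gaussianReal {g : ℝ → ℝ} (hg : AEStronglyMeasurable g (gaussianReal 0 1))
    {C : ℝ} (hC : ∀ x, |g x| ≤ C) : Integrable g (gaussianReal 0 1) :=
  (integrable_const C).mono' hg (ae_of_all _ fun x => (Real.norm_eq_abs _).le.trans (hC x))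

/-- **Stein's lemma for `N(0,1)`**: for `g ∈ C¹` with `g` and `g'` bounded,
`∫ x g(x) dγ(x) = ∫ g'(x) dγ(x)`. Proof: against the density `φ`, integration by parts on `ℝ`
(`integral_mul_deriv_eq_deriv_mul_of_integrable`) with `φ' = -x φ`. -/
theorem pl_stein_gaussianReal {g g' : ℝ → ℝ} (hg : ∀ x, HasDerivAt g (g' x) x) {C : ℝ}
    (hgC : ∀ x, |g x| ≤ C) (hg'C : ∀ x, |g' x| ≤ C) :
    ∫ x, x * g x ∂gaussianReal 0 1 = ∫ x, g' x ∂gaussianReal 0 1 := by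
  set φ : ℝ → ℝ := gaussianPDFReal 0 1 with hφ
  have hgc : Continuous g := continuous_iff_continuousAt.2 fun x => (hg x).continuousAt
  have hgm : AEStronglyMeasurable g (gaussianReal 0 1) := hgc.aestronglyMeasurable
  have hg'm : Measurable g' := by
    have : deriv g = g' := funext fun x => (hg x).deriv
    rw [← this]; exact measurable_deriv g
  -- integrability facts (against `N(0,1)`, then transported to Lebesgue measure with the density)
  have hI1 : Integrable (fun x => x * g x) (gaussianReal 0 1) :=
    pl_integrable_id_gaussianReal.mul_bdd hgm (ae_of_all _ fun x => (Real.norm_eq_abs _).le.trans (hgC x))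
  have hI2 : Integrable g' (gaussianReal 0 1) :=
    pl_integrable_of_bounded_gaussianReal hg'm.aestronglyMeasurable hg'C
  have hI3 : Integrable g (gaussianReal 0 1) := pl_integrable_of_bounded_gaussianReal hgm hgC
  rw [integral_gaussianReal_eq_integral_smul one_ne_zero,
    integral_gaussianReal_eq_integral_smul one_ne_zero]
  simp only [smul_eq_mul]
  rw [pl_integrable_gaussianReal_iff] at hI1 hI2 hI3
  -- integration by parts: `∫ g · φ' = -∫ g' · φ` with `φ' = -x φ`
  have hibp := integral_mul_deriv_eq_deriv_mul_of_integrable (u := g) (u' := g') (v := φ)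
    (v' := fun x => -x * φ x) (fun x _ => hg x) (fun x _ => pl_hasDerivAt_gaussianPDFReal x) ?_ ?_ ?_
  · -- `hibp : ∫ g x * (-x * φ x) = -∫ g' x * φ x`
    have e1 : (fun x => φ x * (x * g x)) = fun x => -(g x * (-x * φ x)) := by funext x; ring
    have e2 : (fun x => φ x * g' x) = fun x => g' x * φ x := by funext x; ring
    rw [e1, integral_neg, hibp, e2, neg_neg]
  · have e : (g * fun x => -x * φ x) = fun x => -(φ x * (x * g x)) := by funext x; simp [hφ]; ring
    rw [e]; exact hI1.neg
  · have e : (g' * φ) = fun x => φ x * g' x := by funext x; simp [hφ]; ring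
    rw [e]; exact hI2
  · have e : (g * φ) = fun x => φ x * g x := by funext x; simp [hφ]; ring
    rw [e]; exact hI3

/-! ### Disintegration of `γ∞` along one coordinate -/

variable {ι : Type*} [DecidableEq ι]

/-- Gluing two noises along `{e}` is updating the coordinate `e`. -/
theorem pl_piecewise_singleton (e : ι) (ω ζ : ι → ℝ) :
    ({e} : Finset ι).piecewise ω ζ = Function.update ζ e (ω e) := by
  funext i
  by_cases h : i = e
  · subst h; simp
  · rw [Finset.piecewise_eq_of_notMem _ _ _ (by simpa using h), Function.update_of_ne h]

variable [Countable ι]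

/-- **Disintegration of the infinite Gaussian product along one coordinate.** For `F` integrable
against `γ∞ = ⨂_e N(0,1)` and a coordinate `e`,
`∫ F dγ∞ = ∫ (∫ F(update ζ e x) dN(0,1)(x)) dγ∞(ζ)`: glue an independent copy of the noise into
coordinate `e` (`infinitePi_prod_map_piecewise`), apply Fubini, and read the inner integral through
the coordinate map (measure preserving). -/
theorem pl_integral_infinitePi_update (e : ι) {F : (ι → ℝ) → ℝ} (hFm : Measurable F)
    (hF : Integrable F (Measure.infinitePi fun _ : ι => gaussianReal 0 1)) :
    ∫ ξ, F ξ ∂Measure.infinitePi (fun _ : ι => gaussianReal 0 1) =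
      ∫ ζ, (∫ x, F (Function.update ζ e x) ∂gaussianReal 0 1)
        ∂Measure.infinitePi (fun _ : ι => gaussianReal 0 1) := by
  set μ : Measure (ι → ℝ) := Measure.infinitePi fun _ : ι => gaussianReal 0 1 with hμ
  have hglue := Literature.Probability.Percolation.infinitePi_prod_map_piecewise
    (fun _ : ι => gaussianReal 0 1) ({e} : Finset ι)
  have hmeas : Measurable fun p : (ι → ℝ) × (ι → ℝ) => ({e} : Finset ι).piecewise p.1 p.2 :=
    Literature.Probability.Percolation.measurable_finsetPiecewise _
  -- `∫ F dμ = ∫ F ∘ glue d(μ ⊗ μ)`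
  have hFm' : AEStronglyMeasurable F ((μ.prod μ).map fun p => ({e} : Finset ι).piecewise p.1 p.2) := by
    rw [hglue]; exact hF.aestronglyMeasurable
  have h1 : ∫ ξ, F ξ ∂μ = ∫ p, F (({e} : Finset ι).piecewise p.1 p.2) ∂μ.prod μ := by
    rw [← integral_map hmeas.aemeasurable hFm', hglue]
  have hint : Integrable (fun p : (ι → ℝ) × (ι → ℝ) => F (({e} : Finset ι).piecewise p.1 p.2))
      (μ.prod μ) :=
    (integrable_map_measure hFm' hmeas.aemeasurable).1 (by rw [hglue]; exact hF)
  rw [h1, integral_prod_symm _ hint]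
  refine integral_congr_ae (ae_of_all _ fun ζ => ?_)
  simp only [pl_piecewise_singleton]
  -- inner integral through the coordinate map `ω ↦ ω e` (measure preserving onto `N(0,1)`)
  have hmp : MeasurePreserving (fun ω : ι → ℝ => ω e) μ (gaussianReal 0 1) :=
    measurePreserving_eval_infinitePi (fun _ : ι => gaussianReal 0 1) e
  have hg : Measurable fun x : ℝ => F (Function.update ζ e x) := hFm.comp (measurable_update ζ)
  have h2 := integral_map (μ := μ) hmp.measurable.aemeasurable
    (hg.aestronglyMeasurable (μ := μ.map fun ω : ι → ℝ => ω e))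
  rw [hmp.map_eq] at h2
  exact h2.symm


omit [DecidableEq ι] [Countable ι] in
/-- Coordinates are integrable against `γ∞`. -/
theorem pl_integrable_eval_infinitePi (e : ι) :
    Integrable (fun ξ : ι → ℝ => ξ e) (Measure.infinitePi fun _ : ι => gaussianReal 0 1) := by
  have hmp : MeasurePreserving (fun ω : ι → ℝ => ω e) (Measure.infinitePi fun _ : ι => gaussianReal 0 1)
      (gaussianReal 0 1) :=
    measurePreserving_eval_infinitePi (fun _ : ι => gaussianReal 0 1) e
  exact (hmp.integrable_comp pl_integrable_id_gaussianReal.aestronglyMeasurable).2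
    pl_integrable_id_gaussianReal

omit [DecidableEq ι] [Countable ι] in
/-- A measurable function bounded in absolute value is integrable against the probability measure
`γ∞`. -/
theorem pl_integrable_of_bounded_infinitePi {F : (ι → ℝ) → ℝ} (hFm : Measurable F) {C : ℝ}
    (hC : ∀ ξ, |F ξ| ≤ C) : Integrable F (Measure.infinitePi fun _ : ι => gaussianReal 0 1) :=
  (integrable_const C).mono' hFm.aestronglyMeasurable
    (ae_of_all _ fun ξ => (Real.norm_eq_abs _).le.trans (hC ξ))

/-- **Gaussian integration by parts along one coordinate of `γ∞ = ⨂_e N(0,1)`.** Let `H`, `D` be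
measurable and bounded, and suppose that for almost every `ζ` the one-coordinate section
`t ↦ H(update ζ e t)` is differentiable at every `t` with derivative `D(update ζ e t)`. Then
`∫ ξ_e H(ξ) dγ∞(ξ) = ∫ D(ξ) dγ∞(ξ)`: disintegrate along `e` (`pl_integral_infinitePi_update`) and
apply Stein's lemma in the coordinate `ξ_e` (`pl_stein_gaussianReal`). This is the one-coordinate
form of the Gaussian integration by parts behind Piterbarg's / Plackett's interpolation formula
(Beliaev–Muirhead–Rivera 2020, proof of Lemma 2.22). -/
theorem pl_stein_infinitePi' (e : ι) {H D : (ι → ℝ) → ℝ} (hHm : Measurable H) (hDm : Measurable D)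
    {C : ℝ} (hHC : ∀ ξ, |H ξ| ≤ C) (hDC : ∀ ξ, |D ξ| ≤ C)
    (hderiv : ∀ᵐ ζ ∂Measure.infinitePi (fun _ : ι => gaussianReal 0 1), ∀ t : ℝ,
      HasDerivAt (fun t => H (Function.update ζ e t)) (D (Function.update ζ e t)) t) :
    ∫ ξ, ξ e * H ξ ∂Measure.infinitePi (fun _ : ι => gaussianReal 0 1) =
      ∫ ξ, D ξ ∂Measure.infinitePi (fun _ : ι => gaussianReal 0 1) := by
  have hF₁m : Measurable fun ξ : ι → ℝ => ξ e * H ξ := (measurable_pi_apply e).mul hHm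
  have hF₁i : Integrable (fun ξ : ι → ℝ => ξ e * H ξ) (Measure.infinitePi fun _ : ι => gaussianReal 0 1) :=
    (pl_integrable_eval_infinitePi e).mul_bdd hHm.aestronglyMeasurable
      (ae_of_all _ fun ξ => (Real.norm_eq_abs _).le.trans (hHC ξ))
  have hF₂i : Integrable D (Measure.infinitePi fun _ : ι => gaussianReal 0 1) :=
    pl_integrable_of_bounded_infinitePi hDm hDC
  rw [pl_integral_infinitePi_update e hF₁m hF₁i, pl_integral_infinitePi_update e hDm hF₂i]
  refine integral_congr_ae ?_
  filter_upwards [hderiv] with ζ hζ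
  simp only [Function.update_self]
  exact pl_stein_gaussianReal (g := fun t => H (Function.update ζ e t))
    (g' := fun t => D (Function.update ζ e t)) hζ (fun t => hHC _) (fun t => hDC _)


/-- **Gaussian integration by parts along one coordinate of `γ∞` (registered form).** The
statement of `pl_stein_infinitePi'` with all binders universally quantified and every notion fully
qualified — the form registered as a sub-goal stub of the crux item (`ledger workitem stub-add`),
so that this helper file of line `registered` lands under `--supports`. -/
theorem pl_stein_infinitePi : ∀ {ι : Type} [DecidableEq ι] [Countable ι] (e : ι) (H D : (ι → ℝ) → ℝ) (C : ℝ), Measurable H → Measurable D → (∀ ξ : ι → ℝ, |H ξ| ≤ C) → (∀ ξ : ι → ℝ, |D ξ| ≤ C) → Filter.Eventually (fun ζ : ι → ℝ => ∀ t : ℝ, HasDerivAt (fun t : ℝ => H (Function.update ζ e t)) (D (Function.update ζ e t)) t) (MeasureTheory.ae (MeasureTheory.Measure.infinitePi (fun _ : ι => ProbabilityTheory.gaussianReal 0 1))) → MeasureTheory.integral (MeasureTheory.Measure.infinitePi (fun _ : ι => ProbabilityTheory.gaussianReal 0 1)) (fun ξ : ι → ℝ => ξ e * H ξ) = MeasureTheory.integral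 (MeasureTheory.Measure.infinitePi (fun _ : ι => ProbabilityTheory.gaussianReal 0 1)) (fun ξ : ι → ℝ => D ξ) := by
  intro ι _ _ e H D C hHm hDm hHC hDC hderiv
  exact pl_stein_infinitePi' e hHm hDm hHC hDC hderiv

end Summit.CriticalPhenomena.CardyFormulaZ2.Cruxes.DriftBound.Birth

end
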